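import Literature.Geometry.Lorentzian.SpacelikeBoundaryLevelSet
import Literature.Geometry.Lorentzian.SpacelikeBoundaryPointExistence
import Literature.Geometry.Lorentzian.CauchyHypersurfaceGlobalHyperbolicity
import HarnessLib

/-!
# A proper globally hyperbolic subregion sharing the Cauchy hypersurface has a temporal
# boundary point whose strict past (or future) side lies inside it

Packaging, for continuation arguments over a spacetime with a Cauchy hypersurface, of the causal
machinery of J. Sbierski, Ann. Henri Poincaré 17 (2016) 301–329 = arXiv:1309.7591v3, §3.2
(Lemmas 15–16 and the hyperboloidal level set of the proof of Thm. 12), formalised in the tree as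
`IsCauchyHypersurface.exists_spacelikeBoundaryPoint` (`SpacelikeBoundaryPointExistence.lean`) and
`IsCauchyHypersurface.exists_levelSet_boundaryPoint_sublevel` (`SpacelikeBoundaryLevelSet.lean`).

Let `(M, g, τ)` be a connected time-oriented Lorentzian manifold (Hausdorff, second countable,
boundaryless finite-dimensional model, `C^∞` metric) with a Cauchy hypersurface `S`, and let
`U ⊆ M` be an open set containing `S` in which `S` is still a Cauchy hypersurface (a "globally
hyperbolic subregion sharing the Cauchy hypersurface": in the applications, the region on which a
solution / a Killing field has already been constructed). Then:

* `IsCauchyHypersurface.frontier_inter_chronological_nonempty_of_ne_univ` — if `U ≠ M`, the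
  frontier of `U` meets `I⁺(S)` or `I⁻(S)` (a timelike curve from `S ⊆ U` to a point off `U`
  crosses `∂U`, and does so off `S`);
* `IsCauchyHypersurface.exists_temporal_boundaryPoint_future` — if `∂U` meets `I⁺(S)`, there are
  a point `p₀ ∈ ∂U ∩ I⁺(S)`, an open `O ∋ p₀` and a function `f`, `C^∞` on `O`, with `f p₀ = 0`,
  `df_{p₀}(v) > 0` for every future-directed `v` (a local temporal function), whose level set
  `{f = 0} ∩ O` lies in `Ū` and whose strict past side `{f < 0} ∩ O` lies in `U`. All the
  global-hyperbolicity inputs of the two Sbierski theorems (compactness of `J⁻(x) ∩ J⁺(S)`,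
  closedness of `J⁻(x)` and of `≤`, the causality condition, strong causality) are consequences
  of the Cauchy hypersurface (`CauchyHypersurfaceGlobalHyperbolicity.lean`), and Lemma 15 is
  applied to the whole of `∂U ∩ I⁺(S)`, for which its two closure hypotheses are trivial;
* `IsCauchyHypersurface.exists_temporal_boundaryPoint_past` — the time dual (reverse `τ`).

This is the selection of the "first point where the known region stops" in a form in which data
can be posed on the smooth spacelike level sets `{f = -η} ⊆ U` approaching `p₀` — the device that
replaces a global smooth temporal function (Bernal–Sánchez) in the globalisation of local
hyperbolic statements, e.g. the Killing development
(`Literature.Geometry.Lorentzian.fischerMarsdenMoncrief_killing_development`, Moncrief 1975, §III).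
Everything is proved; no definitions, no named facts (D-0026).

## References

* J. Sbierski, Ann. Henri Poincaré 17 (2016) 301–329 = arXiv:1309.7591v3, §3.2, Lemmas 15–16
  and proof of Thm. 12 (arXiv numbering). [Sbierski2016AHP]
* B. O'Neill, *Semi-Riemannian geometry with applications to relativity*, Academic Press 1983,
  Ch. 14, Lemma 14.29, Thm. 14.38, Cor. 14.39. [ONeillSemiRiemannian1983]
-/

noncomputable section

open Bundle Set Filter Function TopologicalSpace
open scoped Manifold ContDiff Topology

namespace Literature.Geometry.Lorentzian

variable {E : Type*} [NormedAddCommGroup E] [NormedSpace ℝ E] {H : Type*} [TopologicalSpace H]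
  {I : ModelWithCorners ℝ E H} {M : Type*} [TopologicalSpace M] [ChartedSpace H M]
  [IsManifold I ∞ M]

namespace LorentzianMetric

/-- A preconnected set meeting both an open set and its complement meets its frontier. [folklore] -/
private theorem nonempty_inter_frontier_of_isPreconnected {c : Set M} (hc : IsPreconnected c)
    {U : Set M} (hU : IsOpen U) (h₁ : (c ∩ U).Nonempty) (h₂ : (c ∩ Uᶜ).Nonempty) :
    (c ∩ frontier U).Nonempty := by
  by_contra h
  rw [not_nonempty_iff_eq_empty] at h
  have hsub : c ⊆ U ∪ (closure U)ᶜ := by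
    intro x hx
    by_contra hx'
    simp only [mem_union, mem_compl_iff, not_or, not_not] at hx'
    have hfr : x ∈ frontier U := by
      rw [frontier, hU.interior_eq]
      exact ⟨hx'.2, hx'.1⟩
    exact (eq_empty_iff_forall_notMem.1 h) x ⟨hx, hfr⟩
  have hdisj : Disjoint U (closure U)ᶜ :=
    disjoint_compl_right.mono_left subset_closure
  rcases hc.subset_or_subset hU isClosed_closure.isOpen_compl hdisj hsub with h' | h'
  · obtain ⟨x, hxc, hxU⟩ := h₂
    exact hxU (h' hxc)
  · obtain ⟨x, hxc, hxU⟩ := h₁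
    exact h' hxc (subset_closure hxU)

variable [FiniteDimensional ℝ E] [CompleteSpace E] [T2Space M] [SecondCountableTopology M]
  [I.Boundaryless] {n : ℕ∞ω} {g : LorentzianMetric I n M} [g.HasLeviCivita]
  [CovariantDerivative.ContMDiffCovariantDerivative g.leviCivita 1] (τ : TimeOrientation g)

omit [FiniteDimensional ℝ E] [CompleteSpace E] [T2Space M] [SecondCountableTopology M] [I.Boundaryless]
  [g.HasLeviCivita] [CovariantDerivative.ContMDiffCovariantDerivative g.leviCivita 1] in
/-- **A timelike curve from `S ⊆ U` to a point off `U` crosses `∂U` inside `I⁺(S)`.** If `S ⊆ U`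
with `U` open and `b ∈ I⁺(S) ∖ U`, then `∂U ∩ I⁺(S)` is nonempty: the image of the timelike segment
from `z ∈ S` to `b` is connected, meets `U` (at `z`) and `Uᶜ` (at `b`), hence `∂U`, at a parameter
`t > a` (the point `γ a = z ∈ U` is not on `∂U`), so that the crossing point lies in `I⁺(S)`.
[cite: ONeillSemiRiemannian1983, Ch. 14, Lemma 14.29 (p. 415)] -/
theorem frontier_inter_chronologicalFuture_nonempty_of_mem (hn : 2 ≤ n) {S : Set M} {U : Opens M}
    (hSU : S ⊆ U) {b : M} (hbU : b ∉ U) (hbI : b ∈ g.chronologicalFuture τ S) :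
    (frontier (U : Set M) ∩ g.chronologicalFuture τ S).Nonempty := by
  have hn1 : (1 : ℕ∞ω) ≤ n := le_trans one_le_two hn
  obtain ⟨z, hzS, γ, a, c, hac, hγ, hγa, hγc⟩ := hbI
  have hcont : ContinuousOn γ (Icc a c) := fun t ht ↦
    (hγ.isFutureCausalCurveOn.continuousAt ht).continuousWithinAt
  have hconn : IsPreconnected (γ '' Icc a c) := isPreconnected_Icc.image γ hcont
  obtain ⟨w, ⟨t, ht, rfl⟩, hwfr⟩ := nonempty_inter_frontier_of_isPreconnected hconn U.isOpen
    ⟨γ a, mem_image_of_mem γ (left_mem_Icc.2 hac.le), by rw [hγa]; exact hSU hzS⟩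
    ⟨γ c, mem_image_of_mem γ (right_mem_Icc.2 hac.le), by rw [hγc]; exact hbU⟩
  have hta : a < t := by
    rcases eq_or_lt_of_le ht.1 with h | h
    · exfalso
      have hU : γ t ∈ (U : Set M) := by rw [← h, hγa]; exact hSU hzS
      exact (eq_empty_iff_forall_notMem.1 U.isOpen.inter_frontier_eq) _ ⟨hU, hwfr⟩
    · exact h
  exact ⟨γ t, hwfr, z, hzS, γ, a, t, hta, hγ.mono (Icc_subset_Icc_right ht.2), hγa, rfl⟩

omit [CompleteSpace E] [g.HasLeviCivita] [CovariantDerivative.ContMDiffCovariantDerivative g.leviCivita 1] in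
/-- **If the subregion is proper, its frontier meets `I⁺(S)` or `I⁻(S)`**: for a Cauchy
hypersurface `S ⊆ U`, `U ≠ M`, a point `b ∉ U` lies in `I⁺(S)` or `I⁻(S)` (O'Neill 1983,
Lemma 14.29: `M = I⁻(S) ⊔ S ⊔ I⁺(S)`), and the timelike segment from `S` to `b` crosses `∂U`.
[cite: ONeillSemiRiemannian1983, Ch. 14, Lemma 14.29 (p. 415)] -/
theorem IsCauchyHypersurface.frontier_inter_chronological_nonempty_of_ne_univ (hn : 2 ≤ n)
    {S : Set M} (hS : g.IsCauchyHypersurface τ S) {U : Opens M} (hSU : S ⊆ U)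
    (hne : (U : Set M) ≠ univ) :
    (frontier (U : Set M) ∩ g.chronologicalFuture τ S).Nonempty ∨
      (frontier (U : Set M) ∩ g.chronologicalPast τ S).Nonempty := by
  obtain ⟨b, hbU⟩ := (ne_univ_iff_exists_notMem (U : Set M)).1 hne
  have hbS : b ∉ S := fun h ↦ hbU (hSU h)
  rcases hS.mem_chronologicalFuture_union_chronologicalPast hn hbS with h | h
  · exact Or.inl (frontier_inter_chronologicalFuture_nonempty_of_mem τ hn hSU hbU h)
  · exact Or.inr (frontier_inter_chronologicalFuture_nonempty_of_mem τ.reverse hn hSU hbU h)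

/-- **Temporal boundary point of a proper subregion sharing the Cauchy hypersurface, future side,
with a local temporal function.** Let `S` be a Cauchy hypersurface of the connected `(M, g, τ)`
(`C^∞` metric), `U ⊇ S` open with `S` a Cauchy hypersurface of `(U, g|_U, τ|_U)`, and suppose `∂U`
meets `I⁺(S)`. Then there are `p₀ ∈ ∂U ∩ I⁺(S)`, an open `O ∋ p₀` and `f`, `C^∞` on `O`, with
`f p₀ = 0`, `df_r(v) > 0` for every `r ∈ O` and every future-directed `v ∈ T_rM` (so `f` is a
temporal function on `O`), `{f = 0} ∩ O ⊆ Ū` and `{f < 0} ∩ O ⊆ U`. Proof: Sbierski's Lemma 15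
(`exists_spacelikeBoundaryPoint`) applied to `C = ∂U ∩ I⁺(S)` gives `p` with
`J⁻(p) ∩ ∂U ∩ J⁺(S) = {p}`; then the hyperboloidal level set
(`exists_levelSet_boundaryPoint_temporal`), all global-hyperbolicity inputs coming from `S`.
[cite: Sbierski2016AHP, §3.2, Lemmas 15–16 and proof of Thm. 12 (arXiv numbering)] -/
theorem IsCauchyHypersurface.exists_temporal_boundaryPoint_future' [ConnectedSpace M]
    (hn : (∞ : ℕ∞ω) ≤ n)
    (hres : PseudoRiemannianMetric.contMDiff_restrict (I := I) (n := n) (M := M))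
    (hτ : τ.contMDiff_restrict) {S : Set M} (hS : g.IsCauchyHypersurface τ S) {U : Opens M}
    (hSU : S ⊆ U)
    (hU : (g.restrict hres U).IsCauchyHypersurface (τ.restrict hres hτ U) (Subtype.val ⁻¹' S))
    (hne : (frontier (U : Set M) ∩ g.chronologicalFuture τ S).Nonempty) :
    ∃ (p₀ : M) (O : Set M) (f : M → ℝ), p₀ ∈ frontier (U : Set M) ∧
      p₀ ∈ g.chronologicalFuture τ S ∧ IsOpen O ∧ p₀ ∈ O ∧ ContMDiffOn I 𝓘(ℝ, ℝ) ∞ f O ∧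
      f p₀ = 0 ∧
      (∀ r ∈ O, ∀ v : TangentSpace I r, τ.IsFutureDirected v → (0 : ℝ) < mfderiv I 𝓘(ℝ, ℝ) f r v) ∧
      (∀ r ∈ O, f r = 0 → r ∈ closure (U : Set M)) ∧ ∀ r ∈ O, f r < 0 → r ∈ U := by
  have hn2 : (2 : ℕ∞ω) ≤ n := le_trans (WithTop.coe_le_coe.mpr le_top) hn
  have hK := hS.isCompact_causalPast_inter_causalFuture hn
  have hJ := hS.isClosed_causalPast_singleton hn
  have hcaus := hS.isCausallyWellBehaved hn2
  have hSC := hS.isStronglyCausal hn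
  have hrel : ∀ {xs ys : ℕ → M} {x y : M}, Tendsto xs atTop (𝓝 x) → Tendsto ys atTop (𝓝 y) →
      (∀ j, ys j ∈ g.causalFuture τ {xs j}) → y ∈ g.causalFuture τ {x} :=
    fun hx hy hxy ↦ hS.mem_causalFuture_of_tendsto hn hx hy hxy
  obtain ⟨b, hbfr, hbI⟩ := hne
  obtain ⟨p, ⟨hp, hpI⟩, hsp⟩ := hS.exists_spacelikeBoundaryPoint hn2 hres hτ hSU hU hK hJ hcaus
    (C := frontier (U : Set M) ∩ g.chronologicalFuture τ S) inter_subset_left inter_subset_right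
    (fun z _ ↦ ⟨univ, univ_mem, fun w _ hw hwI ↦ ⟨hw, hwI⟩⟩)
    (fun _ _ _ x₀ _ _ hx₀ hx₀I ↦ ⟨hx₀, hx₀I⟩) ⟨hbfr, hbI⟩
  obtain ⟨p₀, O, f, -, h2, h3, h4, h5, h6, h7, h8, h9, h10⟩ :=
    hS.exists_levelSet_boundaryPoint_temporal τ hn hres hτ hSU hU hK hrel hSC hcaus hp hpI hsp
      univ_mem
  exact ⟨p₀, O, f, h2, h3, h4, h5, h6, h7, h8, h9, h10⟩

/-- **Temporal boundary point, past side, with a local (past-)temporal function** (time dual of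
`exists_temporal_boundaryPoint_future'`, by reversing `τ`): if `∂U` meets `I⁻(S)`, there are
`p₀ ∈ ∂U ∩ I⁻(S)`, an open `O ∋ p₀` and `f`, `C^∞` on `O`, with `f p₀ = 0`, `df_r(v) > 0` for all
`r ∈ O` and all PAST-directed `v`, `{f = 0} ∩ O ⊆ Ū` and `{f < 0} ∩ O ⊆ U`.
[cite: Sbierski2016AHP, §3.2, Lemmas 15–16 and the remark on time reversal (arXiv numbering)] -/
theorem IsCauchyHypersurface.exists_temporal_boundaryPoint_past' [ConnectedSpace M]
    (hn : (∞ : ℕ∞ω) ≤ n)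
    (hres : PseudoRiemannianMetric.contMDiff_restrict (I := I) (n := n) (M := M))
    (hτ : τ.contMDiff_restrict) {S : Set M} (hS : g.IsCauchyHypersurface τ S) {U : Opens M}
    (hSU : S ⊆ U)
    (hU : (g.restrict hres U).IsCauchyHypersurface (τ.restrict hres hτ U) (Subtype.val ⁻¹' S))
    (hne : (frontier (U : Set M) ∩ g.chronologicalPast τ S).Nonempty) :
    ∃ (p₀ : M) (O : Set M) (f : M → ℝ), p₀ ∈ frontier (U : Set M) ∧
      p₀ ∈ g.chronologicalPast τ S ∧ IsOpen O ∧ p₀ ∈ O ∧ ContMDiffOn I 𝓘(ℝ, ℝ) ∞ f O ∧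
      f p₀ = 0 ∧
      (∀ r ∈ O, ∀ v : TangentSpace I r, τ.IsPastDirected v → (0 : ℝ) < mfderiv I 𝓘(ℝ, ℝ) f r v) ∧
      (∀ r ∈ O, f r = 0 → r ∈ closure (U : Set M)) ∧ ∀ r ∈ O, f r < 0 → r ∈ U := by
  have hU' : (g.restrict hres U).IsCauchyHypersurface
      (τ.reverse.restrict hres (τ.contMDiff_restrict_reverse hτ) U) (Subtype.val ⁻¹' S) := by
    rw [← TimeOrientation.restrict_reverse]
    exact hU.reverse
  obtain ⟨p₀, O, f, h1, h2, h3, h4, h5, h6, h7, h8, h9⟩ :=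
    hS.reverse.exists_temporal_boundaryPoint_future' τ.reverse hn hres
      (τ.contMDiff_restrict_reverse hτ) hSU hU' hne
  refine ⟨p₀, O, f, h1, h2, h3, h4, h5, h6, fun r hr v hv ↦ h7 r hr v ?_, h8, h9⟩
  rwa [TimeOrientation.isFutureDirected_reverse_iff]

/-- **Temporal boundary point of a proper subregion sharing the Cauchy hypersurface, future
side.** Let `S` be a Cauchy hypersurface of the connected `(M, g, τ)` (`C^∞` metric), `U ⊇ S` open
with `S` a Cauchy hypersurface of `(U, g|_U, τ|_U)`, and suppose `∂U` meets `I⁺(S)`. Then there are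
`p₀ ∈ ∂U ∩ I⁺(S)`, an open `O ∋ p₀` and `f`, `C^∞` on `O`, with `f p₀ = 0`, `df_{p₀}(v) > 0` for
all future-directed `v`, `{f = 0} ∩ O ⊆ Ū` and `{f < 0} ∩ O ⊆ U`. Proof: Sbierski's Lemma 15
(`exists_spacelikeBoundaryPoint`) applied to `C = ∂U ∩ I⁺(S)` gives `p` with
`J⁻(p) ∩ ∂U ∩ J⁺(S) = {p}`; then the hyperboloidal level set
(`exists_levelSet_boundaryPoint_sublevel`), all global-hyperbolicity inputs coming from `S`.
[cite: Sbierski2016AHP, §3.2, Lemmas 15–16 and proof of Thm. 12 (arXiv numbering)] -/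
theorem IsCauchyHypersurface.exists_temporal_boundaryPoint_future [ConnectedSpace M]
    (hn : (∞ : ℕ∞ω) ≤ n)
    (hres : PseudoRiemannianMetric.contMDiff_restrict (I := I) (n := n) (M := M))
    (hτ : τ.contMDiff_restrict) {S : Set M} (hS : g.IsCauchyHypersurface τ S) {U : Opens M}
    (hSU : S ⊆ U)
    (hU : (g.restrict hres U).IsCauchyHypersurface (τ.restrict hres hτ U) (Subtype.val ⁻¹' S))
    (hne : (frontier (U : Set M) ∩ g.chronologicalFuture τ S).Nonempty) :
    ∃ (p₀ : M) (O : Set M) (f : M → ℝ), p₀ ∈ frontier (U : Set M) ∧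
      p₀ ∈ g.chronologicalFuture τ S ∧ IsOpen O ∧ p₀ ∈ O ∧ ContMDiffOn I 𝓘(ℝ, ℝ) ∞ f O ∧
      f p₀ = 0 ∧ (∀ v : TangentSpace I p₀, τ.IsFutureDirected v → (0 : ℝ) < mfderiv I 𝓘(ℝ, ℝ) f p₀ v) ∧
      (∀ r ∈ O, f r = 0 → r ∈ closure (U : Set M)) ∧ ∀ r ∈ O, f r < 0 → r ∈ U := by
  obtain ⟨p₀, O, f, h1, h2, h3, h4, h5, h6, h7, h8, h9⟩ :=
    hS.exists_temporal_boundaryPoint_future' τ hn hres hτ hSU hU hne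
  exact ⟨p₀, O, f, h1, h2, h3, h4, h5, h6, h7 p₀ h4, h8, h9⟩

/-- **Temporal boundary point, past side** (time dual of
`exists_temporal_boundaryPoint_future`, by reversing `τ`): if `∂U` meets `I⁻(S)`, there are
`p₀ ∈ ∂U ∩ I⁻(S)`, an open `O ∋ p₀` and `f`, `C^∞` on `O`, with `f p₀ = 0`, `df_{p₀}(v) > 0` for all
PAST-directed `v`, `{f = 0} ∩ O ⊆ Ū` and `{f < 0} ∩ O ⊆ U` (now the strict future side).
[cite: Sbierski2016AHP, §3.2, Lemmas 15–16 and the remark on time reversal (arXiv numbering)] -/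
theorem IsCauchyHypersurface.exists_temporal_boundaryPoint_past [ConnectedSpace M]
    (hn : (∞ : ℕ∞ω) ≤ n)
    (hres : PseudoRiemannianMetric.contMDiff_restrict (I := I) (n := n) (M := M))
    (hτ : τ.contMDiff_restrict) {S : Set M} (hS : g.IsCauchyHypersurface τ S) {U : Opens M}
    (hSU : S ⊆ U)
    (hU : (g.restrict hres U).IsCauchyHypersurface (τ.restrict hres hτ U) (Subtype.val ⁻¹' S))
    (hne : (frontier (U : Set M) ∩ g.chronologicalPast τ S).Nonempty) :
    ∃ (p₀ : M) (O : Set M) (f : M → ℝ), p₀ ∈ frontier (U : Set M) ∧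
      p₀ ∈ g.chronologicalPast τ S ∧ IsOpen O ∧ p₀ ∈ O ∧ ContMDiffOn I 𝓘(ℝ, ℝ) ∞ f O ∧
      f p₀ = 0 ∧ (∀ v : TangentSpace I p₀, τ.IsPastDirected v → (0 : ℝ) < mfderiv I 𝓘(ℝ, ℝ) f p₀ v) ∧
      (∀ r ∈ O, f r = 0 → r ∈ closure (U : Set M)) ∧ ∀ r ∈ O, f r < 0 → r ∈ U := by
  obtain ⟨p₀, O, f, h1, h2, h3, h4, h5, h6, h7, h8, h9⟩ :=
    hS.exists_temporal_boundaryPoint_past' τ hn hres hτ hSU hU hne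
  exact ⟨p₀, O, f, h1, h2, h3, h4, h5, h6, h7 p₀ h4, h8, h9⟩

end LorentzianMetric

end Literature.Geometry.Lorentzian

end
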